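import Summits.Ventures.CertifiedManyBodySolver.Downfold.PinnedPairTPrimeOfQuotChainKernelCertsRows
import Summits.Ventures.CertifiedManyBodySolver.Theorems.CovHg1201M19P10BottomOfKernelPair
import HarnessLib
import HarnessLib.Audit

/-!
# Ventures/CertifiedManyBodySolver — Theorems/CovHg1201M19P10BottomOfKernelCertsRows.lean: «PatchBottomP10» (stmt-Ventures-27105, route `CovHg1201M19P10`,
# HgBa₂CuO₄₊δ «Hg-1201» @10 GPa column, n = 22/25) FROM TWO KERNEL CERTIFICATES IN THE «ROWS + HALVING» DESIGN OF RECORD ON THE BOX GEOMETRY — the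
# instance-facing tier-P closer of the K2 bottom pair (§4 of the seat's line «HG-K2-KERNEL-TWIN»)

HONEST FRAMING: ONE theorem. Its hypotheses are of three kinds ONLY: (a) exporter DATA for the two vertices of the K2 bottom `t′`-pair {A = hub at `s = −49/100`,
B = spoke at `s = −12/25`} at the station `U = 3`, solve density `n₀ = 22/25`, corner objective `−X₀(−49/100; Uo)`, in the «(N)-BY-ROWS + ADJOINT HALVING»
design of record (hubbard-cov-la214-plan-1 R-g4-5, hubbard-obs STATUS 2026-08-29T01:07:34Z) on hubbard-obs-p2's box geometry `BoxGeom.boxQuot r R vmax`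
(`7 ≤ R`, `r + 1 ≤ R`, `r + vmax ≤ R`; ONE `Bkey`; ONE shared eom word list `EB`; per vertex `TH hH TE hE TX hX μ ν κ cap κ′ fl K blocks CW hcw AV ns M Cs hC0 Hs
hchain hβ hsl` — the `stepEQA` chain check `ChainQAOK …` and the ONE inequality `β_v ≤ lowerConst (decPoly …) + (μ_v 0 + μ_v 1)(11/25 − ν_v)` are the
`decide`-class kernel facts an instance carries); (b) `norm_num`-class literal checks (multiplier signs, the re-keyed bounds, the chord law's `L` against the
rhs covariance, the floor kind, three strip prices against bar `4767609/10⁷` on `n ∈ [43/50, 22/25]`) — §2 of `Theorems/CovHg1201M19P10BottomOfKernelPair.lean` verbatim; (c) nothing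
else. NO claim node, NO `@[conjecture]`, NO number of record is used or moved; NOTHING is evaluated or instantiated here (no Hg-1201 exporter output exists —
kit-side, not ordered; the (β0)/(β2) probes are INSTRUMENT class and «no Lean proposal comes out of (β2)», captain 2026-08-29T00:33:51Z); the closer of record
`covHg1201M19P10_PatchBottomP10_of_pinHGBp10_boxdual_j317048` (p666540), the registry rows CTL 153 / 154, tiers, margins and the pen HOLD (α′) on stmt-Ventures-27105 are
UNCHANGED; «closed modulo nodes» ≠ proved; no summit statement is proved by this file. ZERO compute, no definition, no `sorry`.

THE CHAIN (every link a tree theorem, BY NAME): exporter data ×2 → hubbard-cov-la214-box-2 g4's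
`TPrimePinnedPairRowWN.of_quotAdjChainKernelCertsTBRowsHalfAuto_box` (`Downfold/PinnedPairTPrimeOfQuotChainKernelCertsRows.lean`, p685457: the sixteen geometry
facts, the PSD-ness of the two-level Gram coefficients, the anti-Hermitian remainder and the eom far check are discharged THERE, generically in `(r, R, vmax)`;
through hubbard-obs-p2's `Rows/CARPolyWindowGramTBRows.lean` / `…CorrWindowCertKernelEomAuto.lean` and hubbard-cov-la214-unc-2's chain / quotient kernels) ⇒ the
pinned `t′`-pair SHAPE `TPrimePinnedPairRowWN 3 (−49/100) (−12/25) capA capB flA flB βA κA κA′ slA βB κB κB′ slB (22/25) (−X₀)` → this seat's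
`covHg1201M19P10_PatchBottomP10_of_pairT` (p685040 §2: re-key, chord law p682633, box-2 g1's `…_of_bundleWN_affineCap` p646114) ⇒ `Theses.CovHg1201M19P10.PatchBottomP10`;
@0 / @10 columns certified separately — no pressure / dT_c-dP sentence.

Cell `hubbard-obs` (D-0154 (1)(C) Hg-1201), seat hubbard-cov-hg1201-box-2 g4 (`prover-hubbard-cov-hg1201-box-2-g4-0`), typist desk; wording class (xx1):
CONTROL / CALIBRATION one-sided stiffness-scale ceilings of a downfolded screening-grade one-band box; a ceiling never speaks to the presence of superconductivity
or to `ρ_s = 0`; not a `T_c` / phase / pressure sentence; nothing about HgBa₂CuO₄₊δ samples.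

References: X. Han, arXiv:2006.06002 §3 [Han2020Bootstrap]; J. Wang et al., PRX 14 (2024) 031006 §III [WangEtAl2024]; C. Jansson, D. Chaykin, C. Keil,
SIAM J. Numer. Anal. 46 (2008) 180 §3 [JanssonChaykinKeil2008]; T. Koma, H. Tasaki, J. Stat. Phys. 76 (1994) 745 §1 [KomaTasaki1994]; S. Boyd,
L. Vandenberghe, *Convex Optimization* (2004) §5.9 [BoydVandenberghe2004]; D. J. Scalapino, S. R. White, S.-C. Zhang, PRB 47 (1993) 7995 §II
[ScalapinoWhiteZhang1993].
-/

noncomputable section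

namespace Summit.Ventures.CertifiedManyBodySolver.Theorems

open Summit.Ventures.CertifiedManyBodySolver.Theses.CovHg1201M19P10 (PatchBottomP10)
open Summit.Ventures.CertifiedManyBodySolver.Downfold Summit.Ventures.CertifiedManyBodySolver
open Summit.Ventures.CertifiedManyBodySolver.Observables
open Summit.Ventures.CertifiedQuantumChemistry Summit.Ventures.CertifiedQuantumChemistry.CARPoly
open Summit.Ventures.CertifiedManyBodySolver.CARPolyWindow Summit.Ventures.CertifiedManyBodySolver.CARPolyWindow.BoxGeom
open Literature.MathematicalPhysics.QuantumManyBody.StateRelaxation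
open Literature.MathematicalPhysics.QuantumLattice Literature.MathematicalPhysics.QuantumLattice.ThermodynamicLimit
open Literature.Probability.LatticeModels
open Matrix Filter Topology HubbardWave0
open scoped BigOperators ComplexOrder

/-- **«PatchBottomP10» (stmt-Ventures-27105) FROM TWO KERNEL CERTIFICATES IN THE «ROWS + HALVING» DESIGN OF RECORD ON THE BOX GEOMETRY `boxQuot r R vmax`** —
the K2″ bottom `t′`-pair {A hub `s = −49/100`, B spoke `s = −12/25`; `U = 3`, `n₀ = 22/25`; ONE `Bkey`, ONE shared `EB`; corner objective
`Γ(incl)(−oddMomentObsTT (−49/100) Uo 0)` at both vertices}: per vertex the instance supplies `TH hH TE hE TX hX μ ν κ cap κ′ fl K blocks CW hcw AV ns M Cs hC0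
Hs hchain hβ hsl` only; then the literal checks of `covHg1201M19P10_PatchBottomP10_of_pairT` (signs, re-keyed bounds onto the cap plane of record / kinematic floor,
`L` vs. the rhs covariance, floor kind, three strip prices). Conclusion: the route decl — NO claim node; nothing instantiated in this file.
[cite: Han2020Bootstrap, §3] [cite: WangEtAl2024, §III] [cite: JanssonChaykinKeil2008, §3] [cite: KomaTasaki1994, §1] [cite: BoydVandenberghe2004, §5.9] -/
theorem covHg1201M19P10_PatchBottomP10_of_kernelCertsRows (Uo : ℝ)
    (r R vmax : ℕ) (h7R : 7 ≤ R) (hrR : r + 1 ≤ R) (hvR : r + vmax ≤ R) (Bkey : ℕ)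
    -- the SHARED eom words (inner window letters)
    (EB : List (Terms (Orb (Fin (boxN r)))))
    -- vertex A (hub, `s = −49/100`)
    (THA : Terms (Orb (Fin (boxN R))))
    (hHA : termOp (boxD R) THA =
      (hubbardTTPrimeFermionInteraction 1 (((-49 / 100 : ℚ)) : ℝ) (((3 : ℚ)) : ℝ)).localHamiltonian (boxW R))
    (TEA : Terms (Orb (Fin (boxN R))))
    (hEA : termOp (boxD R) TEA =
      fermionEmbed (PolySite.incl (thicken01_subset_boxW (le_trans (by norm_num) h7R)))
        ((hubbardTTPrimeFermionInteraction 1 (((-49 / 100 : ℚ)) : ℝ) (((3 : ℚ)) : ℝ)).meanEnergyObs 1))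
    (TXA : Terms (Orb (Fin (boxN R))))
    (hXA : termOp (boxD R) TXA = fermionEmbed (PolySite.incl (box_subset_boxW h7R)) (-oddMomentObsTT (-49 / 100) Uo 0))
    (μA : Fin 2 → ℚ) (νA κA capA κA' flA : ℚ) (KA : ℕ) (blocksA : List (List (List ℤ × Terms (Orb (Fin (boxN R))))))
    (CWA : Terms (Orb (Fin (boxN R)))) (hcwA : ∀ wc ∈ CWA, chargeW wc.1 ≠ 0 ∨ spinChargeW (fun a => (ofLex a).2) wc.1 ≠ 0)
    (AVA : List (Terms (Orb (Fin (boxN R)))))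
    (nsA : List ℕ) (MA : ℕ) (CsA : List SOSDual.EncPoly) (hC0A : CsA.getD 0 [] = []) (HsA : List (List (QHint (boxN r))))
    (hchainA : ChainQAOK (boxQuot r R vmax) Bkey MA CsA
      (groupSlices (residTGslicesNear TXA μA νA (fun σ => orb (boxIx R 0) σ) κA capA κA' flA TEA (gramTBRowsHalf KA blocksA) THA (boxPush r R) EB
        (autoMasks THA (boxPush r R) EB) (fun l : Fin 0 => l.elim0) (fun l : Fin 0 => l.elim0) CWA AVA) nsA) HsA)
    {βA : ℚ}
    (hβA : haveI := neZero_boxN R; βA ≤ lowerConst (SOSDual.decPoly (boxN R) (CsA.getD MA [])) + (μA 0 + μA 1) * ((22 / 25 : ℚ) / 2 - νA))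
    {slA : ℚ} (hslA : slA = (μA 0 + μA 1) / 2)
    -- vertex B (spoke, `s = −12/25`)
    (THB : Terms (Orb (Fin (boxN R))))
    (hHB : termOp (boxD R) THB =
      (hubbardTTPrimeFermionInteraction 1 (((-12 / 25 : ℚ)) : ℝ) (((3 : ℚ)) : ℝ)).localHamiltonian (boxW R))
    (TEB : Terms (Orb (Fin (boxN R))))
    (hEB : termOp (boxD R) TEB =
      fermionEmbed (PolySite.incl (thicken01_subset_boxW (le_trans (by norm_num) h7R)))
        ((hubbardTTPrimeFermionInteraction 1 (((-12 / 25 : ℚ)) : ℝ) (((3 : ℚ)) : ℝ)).meanEnergyObs 1))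
    (TXB : Terms (Orb (Fin (boxN R))))
    (hXB : termOp (boxD R) TXB = fermionEmbed (PolySite.incl (box_subset_boxW h7R)) (-oddMomentObsTT (-49 / 100) Uo 0))
    (μB : Fin 2 → ℚ) (νB κB capB κB' flB : ℚ) (KB : ℕ) (blocksB : List (List (List ℤ × Terms (Orb (Fin (boxN R))))))
    (CWB : Terms (Orb (Fin (boxN R)))) (hcwB : ∀ wc ∈ CWB, chargeW wc.1 ≠ 0 ∨ spinChargeW (fun a => (ofLex a).2) wc.1 ≠ 0)
    (AVB : List (Terms (Orb (Fin (boxN R)))))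
    (nsB : List ℕ) (MB : ℕ) (CsB : List SOSDual.EncPoly) (hC0B : CsB.getD 0 [] = []) (HsB : List (List (QHint (boxN r))))
    (hchainB : ChainQAOK (boxQuot r R vmax) Bkey MB CsB
      (groupSlices (residTGslicesNear TXB μB νB (fun σ => orb (boxIx R 0) σ) κB capB κB' flB TEB (gramTBRowsHalf KB blocksB) THB (boxPush r R) EB
        (autoMasks THB (boxPush r R) EB) (fun l : Fin 0 => l.elim0) (fun l : Fin 0 => l.elim0) CWB AVB) nsB) HsB)
    {βB : ℚ}
    (hβB : haveI := neZero_boxN R; βB ≤ lowerConst (SOSDual.decPoly (boxN R) (CsB.getD MB [])) + (μB 0 + μB 1) * ((22 / 25 : ℚ) / 2 - νB))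
    {slB : ℚ} (hslB : slB = (μB 0 + μB 1) / 2)
    -- multiplier signs
    (hκA : 0 ≤ κA) (hκA' : 0 ≤ κA') (hκB : 0 ≤ κB) (hκB' : 0 ≤ κB')
    -- the re-keyed bounds, the law's `L`, the floor kind, the three strip prices (as in `covHg1201M19P10_PatchBottomP10_of_pairT`)
    {βAs βBs F L : ℚ}
    (hβAs : βAs ≤ βA - κA * ((-10022689/10000000 : ℚ) - capA) - κA' * (flA - (-124827703/50000000)))
    (hβBs : βBs ≤ βB - κB * ((-1250541281/1250000000 : ℚ) - capB) - κB' * (flB - (-124827703/50000000)))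
    (hL₁ : (16211390 / 10000000 : ℚ) * (1 / 100) * ((κA - κA') - (κB - κB')) - (κB - κA) * (573711/312500000) ≤ L)
    (hL₂ : (16211390 / 10000000 : ℚ) * (1 / 100) * -((κA - κA') - (κB - κB')) - (κB - κA) * (573711/312500000) ≤ L)
    (hkind : (0 ≤ L ∧ βAs + L ≤ βBs ∧ F ≤ βAs) ∨ (0 ≤ L ∧ βBs + L ≤ βAs ∧ F ≤ βBs) ∨
      (0 < L ∧ F ≤ βAs - (L - (βBs - βAs)) ^ 2 / (4 * L)))
    (p₀ : -F ≤ 4767609 / 10000000) (p₁ : -F - slA * (43 / 50 - 22 / 25) ≤ 4767609 / 10000000)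
    (p₂ : -F - slB * (43 / 50 - 22 / 25) ≤ 4767609 / 10000000) :
    PatchBottomP10 := by
  -- (1) the pinned `t′`-pair shape from the two «rows + halving» box certificates (shared `EB`, one `Bkey`)
  have hAB := TPrimePinnedPairRowWN.of_quotAdjChainKernelCertsTBRowsHalfAuto_box r R vmax h7R hrR hvR 3 (by norm_num) (22 / 25)
    (-49 / 100) (-12 / 25) Bkey (-oddMomentObsTT (-49 / 100) Uo 0) EB
    THA hHA TEA hEA TXA hXA μA νA κA capA κA' flA KA blocksA CWA hcwA AVA nsA MA CsA hC0A HsA hchainA hβA hslA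
    THB hHB TEB hEB TXB hXB μB νB κB capB κB' flB KB blocksB CWB hcwB AVB nsB MB CsB hC0B HsB hchainB hβB hslB
  -- (2) numerals
  have e1 : (((3 : ℚ)) : ℝ) = 3 := by norm_num
  have e2 : (((-49 / 100 : ℚ)) : ℝ) = -49 / 100 := by norm_num
  have e3 : (((-12 / 25 : ℚ)) : ℝ) = -12 / 25 := by norm_num
  rw [e1, e2, e3] at hAB
  -- (3) the item from the pair
  exact covHg1201M19P10_PatchBottomP10_of_pairT Uo hAB hκA hκA' hκB hκB' hβAs hβBs hL₁ hL₂ hkind p₀ p₁ p₂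

end Summit.Ventures.CertifiedManyBodySolver.Theorems

end
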